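import Mathlib
import Literature.Analysis.FluidPDE.SubMeanValue
import Literature.Analysis.FluidPDE.SelfSimilarEulerProfilePressureLaplacian
import Literature.Analysis.FluidPDE.SelfSimilarEulerProfileVorticity
import HarnessLib

/-!
# PRESSURE PEAKS ARE STRAIN-DOMINATED — the `Q`-criterion reading of target T2 («pressurised stagnant tubes») for the crux
# `EulerZoomLiouville.PowerGaugeEulerLiouville` (stmt-NavierStokesRegularity-19832; LEAD ns-typeII-p2 g12 RESIDUE-MEMO §2 T2 / §6,
# 16:39:59Z (c) «ezl-w1 = pressure parking / sub-mean-value → T2»; width seat ns-ezl-w1 g4)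

Route №10 `EulerZoomLiouville` (NavierStokesRegularity).  For a `C²` self-similar Euler profile `(V, P′)` (CIV (3.3)) on `ℝ³` the
pressure Poisson equation reads `ΔP′ = |curl V|² − |∇V|²_F` (tree `IsSelfSimilarEulerProfile.laplacian_pressure_eq_sq_norm_curl_sub`,
this seat p644226), i.e. `−ΔP′ = |∇V|²_F − |ω|² = |S|² − ½|ω|² =: STRAIN EXCESS` (twice Hunt–Wray–Moin's `−Q`).  The EXACT mean-value
defect identity for the unit-mass probe bump (`Literature…exists_probeBump_defect_eq`, this seat p652117) then gives, for every centre
`x₀` and radius `R`: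

* `pressure_defect_eq_strainExcess` — `P′(x₀) − ∫ χ_R(y) P′(x₀+y) dy = ∫₀¹ s ∫ Q_R(y) (|∇V|²_F − |curl V|²)(x₀ + s y) dy ds` with an
  explicit kernel `0 ≤ Q_R ≤ 2/(m R)` supported in `B_{2R}` (a positive Green-type average of the strain excess over `B_{2R}(x₀)`);
* `strainExcess_mass_ge_of_pressure_excess` — a PRESSURE EXCESS `κL² + ∫ χ_R P′(x₀+·) ≤ P′(x₀)` forces the weighted strain-excess
  mass near `x₀` to be `≥ κ L²`;
* `exists_strainDominated_near_pressure_excess` — hence some point of `B_{2R}(x₀)` is STRAIN-DOMINATED: `|curl V|² < |∇V|²_F`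
  (`|S|² > ½|ω|²`, the `Q < 0` region of the `Q`-criterion).

READING FOR THE NEEDLE (T2): the pressurised SLOW VORTICAL Bernoulli-high far points of THE ONE STATEMENT (negations of
`HasVorticalBernoulliBound` / `HasFastVorticalChannel`) are vortical (`curl V ≠ 0`) but sit in STRAIN-DOMINATED cores: with the
averaged pressure budget (`PressureParking.integral_probeBump_pressure_le`, `R ≍ L^{−(1+2ρ)/3}`) the strain-dominated point lies within
`≲ L^{−(1+2ρ)/3}` of the pressurised point, and with the `E`-gauge (`…pressure_excess_le_two_scale`) the gradient spikes there are
critical, `|∇V| ≳ κ^{3/2} L^{2+ρ}` (p645610/p646927).  The missing CAPACITY estimate (RESIDUE-MEMO §6) is untouched.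

HONEST LABEL: profile-level portrait TOOL (touches no binder).  WHAT THIS IS NOT: not NS, not E — `--supports` stmt-19832; 19832 OPEN;
NS regularity NOT proved. [cite: GilbargTrudinger2001, Thm. 2.1; ConstantinIgnatovaVicol2026Putative §3.1.1 (3.3)]
-/

noncomputable section

-- flat `Theorems/<Route><Decl>…` files of one crux share the namespace of the crux (tree convention)
set_option linter.dupNamespace false

open MeasureTheory Set Filter Topology Metric Function InnerProductSpace TopologicalSpace
open scoped RealInnerProductSpace NNReal ENNReal Laplacian

namespace Summit.NavierStokesRegularity.NavierStokesRegularity.Theorems.PowerGaugeEulerLiouville.PressureParking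

open Literature.Analysis Literature.Analysis.FluidPDE

/-- **PRESSURE DEFECT = POSITIVE AVERAGE OF THE STRAIN EXCESS.**  For a `C²` self-similar Euler profile `(V, P′)` on `ℝ³` and every
radius `R > 0` there is an explicit kernel `Q` (continuous, `0 ≤ Q ≤ 2R²(m R³)⁻¹`, supported in `‖y‖ ≤ 2R`) with, for every centre `x₀`,
`P′(x₀) − ∫ χ_R(y) P′(x₀+y) dy = ∫₀¹ s ∫ Q(y) (|∇V|²_F − |curl V|²)(x₀ + s y) dy ds`
(`exists_probeBump_defect_eq` + `ΔP′ = |curl V|² − |∇V|²_F`). [cite: GilbargTrudinger2001, Thm. 2.1] -/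
theorem pressure_defect_eq_strainExcess {γ : ℝ} {c : EuclideanSpace ℝ (Fin 3)}
    {V : EuclideanSpace ℝ (Fin 3) → EuclideanSpace ℝ (Fin 3)} {P' : EuclideanSpace ℝ (Fin 3) → ℝ}
    (hprof : IsSelfSimilarEulerProfile γ c V P') {R : ℝ} (hR : 0 < R) :
    ∃ Q : EuclideanSpace ℝ (Fin 3) → ℝ, Continuous Q ∧ (∀ y, 0 ≤ Q y) ∧ (∀ y, 2 * R ≤ ‖y‖ → Q y = 0) ∧
      (∀ y, Q y ≤ 2 * R ^ 2 * (baseBumpMass (EuclideanSpace ℝ (Fin 3)) *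
        R ^ Module.finrank ℝ (EuclideanSpace ℝ (Fin 3)))⁻¹) ∧
      ∀ x₀ : EuclideanSpace ℝ (Fin 3), P' x₀ - (∫ y, probeBump R y * P' (x₀ + y)) =
        ∫ s in (0 : ℝ)..1, s * ∫ y, Q y *
          (frobeniusNormSq (fderiv ℝ V (x₀ + s • y)) - ‖curl V (x₀ + s • y)‖ ^ 2) := by
  obtain ⟨Q, hQc, hQ0, hQsupp, hQle, hid⟩ := exists_probeBump_defect_eq hprof.contDiff_two_pressure hR
  refine ⟨Q, hQc, hQ0, hQsupp, hQle, fun x₀ => ?_⟩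
  rw [hid x₀]
  refine intervalIntegral.integral_congr fun s _ => ?_
  congr 1
  refine integral_congr_ae (Eventually.of_forall fun y => ?_)
  simp only [hprof.laplacian_pressure_eq_sq_norm_curl_sub, neg_sub]

/-- **A PRESSURE EXCESS FORCES STRAIN-EXCESS MASS.**  If `κ L² + ∫ χ_R P′(x₀+·) ≤ P′(x₀)`, then the kernel-weighted strain excess
near `x₀` is at least `κ L²`: `κ L² ≤ ∫₀¹ s ∫ Q(y) (|∇V|²_F − |curl V|²)(x₀ + s y) dy ds`. [cite: GilbargTrudinger2001, Thm. 2.1] -/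
theorem strainExcess_mass_ge_of_pressure_excess {γ : ℝ} {c : EuclideanSpace ℝ (Fin 3)}
    {V : EuclideanSpace ℝ (Fin 3) → EuclideanSpace ℝ (Fin 3)} {P' : EuclideanSpace ℝ (Fin 3) → ℝ}
    (hprof : IsSelfSimilarEulerProfile γ c V P') {R : ℝ} (hR : 0 < R) :
    ∃ Q : EuclideanSpace ℝ (Fin 3) → ℝ, Continuous Q ∧ (∀ y, 0 ≤ Q y) ∧ (∀ y, 2 * R ≤ ‖y‖ → Q y = 0) ∧
      (∀ y, Q y ≤ 2 * R ^ 2 * (baseBumpMass (EuclideanSpace ℝ (Fin 3)) *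
        R ^ Module.finrank ℝ (EuclideanSpace ℝ (Fin 3)))⁻¹) ∧
      ∀ (x₀ : EuclideanSpace ℝ (Fin 3)) (κ L : ℝ),
        κ * L ^ 2 + (∫ y, probeBump R y * P' (x₀ + y)) ≤ P' x₀ →
        κ * L ^ 2 ≤ ∫ s in (0 : ℝ)..1, s * ∫ y, Q y *
          (frobeniusNormSq (fderiv ℝ V (x₀ + s • y)) - ‖curl V (x₀ + s • y)‖ ^ 2) := by
  obtain ⟨Q, hQc, hQ0, hQsupp, hQle, hid⟩ := pressure_defect_eq_strainExcess hprof hR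
  refine ⟨Q, hQc, hQ0, hQsupp, hQle, fun x₀ κ L hex => ?_⟩
  rw [← hid x₀]
  linarith

/-- **PRESSURE PEAKS ARE STRAIN-DOMINATED.**  If `κ L² + ∫ χ_R P′(x₀+·) ≤ P′(x₀)` with `κ L² > 0`, some point `z ∈ B_{2R}(x₀)` is
strain-dominated, `|curl V(z)|² < |∇V(z)|²_F` (equivalently `|S|² > ½|ω|²`, the `Q < 0` region of the `Q`-criterion): otherwise the
strain excess is `≤ 0` on `B_{2R}(x₀)` and so is its positive average. [cite: GilbargTrudinger2001, Thm. 2.1] -/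
theorem exists_strainDominated_near_pressure_excess {γ : ℝ} {c : EuclideanSpace ℝ (Fin 3)}
    {V : EuclideanSpace ℝ (Fin 3) → EuclideanSpace ℝ (Fin 3)} {P' : EuclideanSpace ℝ (Fin 3) → ℝ}
    (hprof : IsSelfSimilarEulerProfile γ c V P') {R : ℝ} (hR : 0 < R) (x₀ : EuclideanSpace ℝ (Fin 3)) {κ L : ℝ}
    (hκL : 0 < κ * L ^ 2) (hex : κ * L ^ 2 + (∫ y, probeBump R y * P' (x₀ + y)) ≤ P' x₀) :
    ∃ z ∈ ball x₀ (2 * R), ‖curl V z‖ ^ 2 < frobeniusNormSq (fderiv ℝ V z) := by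
  obtain ⟨Q, -, hQ0, hQsupp, -, hmass⟩ := strainExcess_mass_ge_of_pressure_excess hprof hR
  have h := hmass x₀ κ L hex
  by_contra hno
  push Not at hno
  -- the strain excess is `≤ 0` on `B_{2R}(x₀)`, so every inner integral is `≤ 0`
  have hinner : ∀ s ∈ Icc (0 : ℝ) 1, ∫ y, Q y *
      (frobeniusNormSq (fderiv ℝ V (x₀ + s • y)) - ‖curl V (x₀ + s • y)‖ ^ 2) ≤ 0 := by
    intro s hs
    refine integral_nonpos fun y => ?_
    by_cases hy : ‖y‖ < 2 * R
    · have hz : x₀ + s • y ∈ ball x₀ (2 * R) := by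
        rw [mem_ball, dist_eq_norm, add_sub_cancel_left, norm_smul, Real.norm_of_nonneg hs.1]
        nlinarith [hs.2, norm_nonneg y]
      exact mul_nonpos_of_nonneg_of_nonpos (hQ0 y) (by linarith [hno _ hz])
    · rw [hQsupp y (not_lt.1 hy), zero_mul]
      exact le_rfl
  have hout : ∫ s in (0 : ℝ)..1, s * ∫ y, Q y *
      (frobeniusNormSq (fderiv ℝ V (x₀ + s • y)) - ‖curl V (x₀ + s • y)‖ ^ 2) ≤ 0 := by
    have hneg : 0 ≤ ∫ s in (0 : ℝ)..1, -(s * ∫ y, Q y *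
        (frobeniusNormSq (fderiv ℝ V (x₀ + s • y)) - ‖curl V (x₀ + s • y)‖ ^ 2)) :=
      intervalIntegral.integral_nonneg zero_le_one fun s hs =>
        neg_nonneg.2 (mul_nonpos_of_nonneg_of_nonpos hs.1 (hinner s hs))
    rw [intervalIntegral.integral_neg] at hneg
    linarith
  linarith

end Summit.NavierStokesRegularity.NavierStokesRegularity.Theorems.PowerGaugeEulerLiouville.PressureParking

end
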